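import Mathlib
import Summits.CriticalPhenomena.SAWScalingLimit.Theorems.SAWRestrictionRigidityAxiomsOfLimitMarkovPathPreHitting
import Summits.CriticalPhenomena.SAWScalingLimit.Theorems.SAWRestrictionRigidityAxiomsOfLimitMarkovKernelAssembly
import HarnessLib

/-!
# One kernel for all hitting times on path space (soft-Markov brick E1)

Crux `AxiomsOfLimit` (stmt-CriticalPhenomena-1370), line `registered`, stub `stub_markovOfLimit`,
soft-Markov brick E1 "one kernel for all hitting times on path space" (lead c4). Theorems only.

On the path space `C([0,1], ℂ)` with the canonical filtration `𝔽 t = σ(path stopped at t)` (given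
abstractly through the hypothesis `h𝔽`), let `μ` be a finite measure whose paths start a.e. at a fixed
point `a`. For a closed set `F` write `τ_F` for the hitting parameter of `F` and
`X_F ω := (τ_F ω, ω^{τ_F})` for the pair (hitting time, path stopped at the hitting time).

* `neBot_comap_ratCast_nhdsLT` — rationals accumulate at every real from the left.
* `exists_seq_isPiSystem_generateFrom` — a countably generated σ-algebra (e.g. the Borel σ-algebra of
  path space) is generated by a countable π-system `(A k)_{k ∈ ℕ}` (the set algebra generated by a
  countable generating family).
* `comap_hitPair_eq` — `σ(X_F) = σ(ω^{τ_F})`: the hitting time is a function of the stopped path.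
* `condExp_comap_hitPair_ae_eq_limUnder` — for a.e. path starting outside `F`, the conditional
  expectation of any real `ξ` given `σ(X_F)` is the left limit at `τ_F` of the rational martingale
  `q ↦ μ[ξ | 𝔽 q]` evaluated AT THE STOPPED PATH — an `F`-independent functional
  `Z_ξ (τ_F ω, ω^{τ_F})` (theorem (P), `ae_tendsto_condExp_preHitting`, p161534, plus adaptedness:
  `μ[ξ | 𝔽 q] (ω^{τ_F}) = μ[ξ | 𝔽 q] ω` for `q < τ_F ω`).
* `exists_pathKernel` / `stub_pathKernel` — feeding the functionals `Z_{1_{A k}}` to the kernel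
  assembly `exists_forall_condDistrib_apply_ae_eq` (p158860) gives ONE map
  `K : ℝ × C([0,1], ℂ) → Measure C([0,1], ℂ)` with `condDistrib id X_F μ (X_F ω) = K (X_F ω)` a.e.,
  simultaneously for every closed `F ∌ a`.

This is Knight's prediction process / the predictable projection at announceable times:
C. Dellacherie, P.-A. Meyer, *Probabilités et potentiel* B, VI.43–45; O. Kallenberg, *Foundations of
Modern Probability* (2002), Thm. 6.3 and Lemma 25.2. All [folklore].
-/

noncomputable section

open MeasureTheory ProbabilityTheory Filter Topology Set

namespace Summit.CriticalPhenomena.SAWScalingLimit.Theorems.AxiomsOfLimitMarkov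

open Literature.Probability.RandomPlanarGeometry

/-- The path `ω` stopped at real time `t`: `u ↦ ω (min u (projIcc t))`. [folklore] -/
local notation3 "stp[" t ", " ω "]" =>
  ContinuousMap.comp ω (ContinuousMap.id unitInterval ⊓
    ContinuousMap.const unitInterval (Set.projIcc (0:ℝ) 1 zero_le_one t))

/-- The hitting parameter of `F` by the path `ω`. [folklore] -/
local notation3 "hit[" F ", " ω "]" => Curve.hitParam F (Curve.mk ω)

/-- Rationals accumulate from the left at every real: the rational trace of `𝓝[<] u` is a proper
filter. [folklore] -/
theorem neBot_comap_ratCast_nhdsLT (u : ℝ) : (comap (fun q : ℚ => (q : ℝ)) (𝓝[<] u)).NeBot := by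
  refine comap_neBot fun t ht => ?_
  obtain ⟨l, hl, hlt⟩ := mem_nhdsLT_iff_exists_Ioo_subset.1 ht
  obtain ⟨q, hlq, hqu⟩ := exists_rat_btwn (mem_Iio.1 hl)
  exact ⟨q, hlt ⟨hlq, hqu⟩⟩

/-- A countably generated σ-algebra is generated by a countable π-system of measurable sets enumerated
by `ℕ`: the set algebra generated by a countable generating family. [folklore] -/
theorem exists_seq_isPiSystem_generateFrom (Ω : Type*) [m : MeasurableSpace Ω]
    [MeasurableSpace.CountablyGenerated Ω] :
    ∃ A : ℕ → Set Ω, (∀ k, MeasurableSet (A k)) ∧ IsPiSystem (range A) ∧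
      m = MeasurableSpace.generateFrom (range A) := by
  obtain ⟨A, hA⟩ : ∃ A : ℕ → Set Ω,
      generateSetAlgebra (MeasurableSpace.countableGeneratingSet Ω) = range A :=
    (countable_generateSetAlgebra MeasurableSpace.countable_countableGeneratingSet).exists_eq_range
      ⟨∅, isSetAlgebra_generateSetAlgebra.empty_mem⟩
  have hgen : m = MeasurableSpace.generateFrom (range A) := by
    rw [← hA, generateFrom_generateSetAlgebra_eq, MeasurableSpace.generateFrom_countableGeneratingSet]
  refine ⟨A, fun k => ?_, ?_, hgen⟩
  · have h : MeasurableSet[MeasurableSpace.generateFrom (range A)] (A k) :=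
      MeasurableSpace.measurableSet_generateFrom ⟨k, rfl⟩
    rwa [← hgen] at h
  · rw [← hA]
    exact fun s hs t ht _ => isSetAlgebra_generateSetAlgebra.inter_mem hs ht

section PathSpace

variable [MeasurableSpace C(unitInterval, ℂ)] [BorelSpace C(unitInterval, ℂ)]

/-- The pair (hitting time, stopped path) generates the same σ-algebra as the stopped path alone:
the hitting parameter of the closed set `F` is a Borel function of the path stopped there
(`hit_stp_hit`). [folklore] -/
theorem comap_hitPair_eq {F : Set ℂ} (hF : IsClosed F) :
    MeasurableSpace.comap (fun ω : C(unitInterval, ℂ) => (hit[F, ω], stp[hit[F, ω], ω]))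
        inferInstance =
      MeasurableSpace.comap (fun ω : C(unitInterval, ℂ) => stp[hit[F, ω], ω]) inferInstance := by
  have hτ : Measurable fun w : C(unitInterval, ℂ) => hit[F, w] := Curve.measurable_hitParam_mk hF
  -- the pair factors through the stopped path
  have hcomp : (fun ω : C(unitInterval, ℂ) => (hit[F, ω], stp[hit[F, ω], ω])) =
      (fun w : C(unitInterval, ℂ) => (hit[F, w], w)) ∘
        fun ω : C(unitInterval, ℂ) => stp[hit[F, ω], ω] := by
    funext ω
    simp only [Function.comp_apply, hit_stp_hit hF Subset.rfl ω]
  -- and `w ↦ (τ_F w, w)` generates the full Borel σ-algebra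
  have hφ : MeasurableSpace.comap (fun w : C(unitInterval, ℂ) => (hit[F, w], w))
      (inferInstance : MeasurableSpace (ℝ × C(unitInterval, ℂ))) =
        (inferInstance : MeasurableSpace C(unitInterval, ℂ)) := by
    refine le_antisymm (hτ.prodMk measurable_id).comap_le ?_
    calc (inferInstance : MeasurableSpace C(unitInterval, ℂ))
        = MeasurableSpace.comap (Prod.snd ∘ fun w : C(unitInterval, ℂ) => (hit[F, w], w))
            inferInstance := by
          rw [show (Prod.snd ∘ fun w : C(unitInterval, ℂ) => (hit[F, w], w)) = id from rfl,
            MeasurableSpace.comap_id]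
      _ ≤ MeasurableSpace.comap (fun w : C(unitInterval, ℂ) => (hit[F, w], w)) inferInstance := by
          rw [← MeasurableSpace.comap_comp]
          exact MeasurableSpace.comap_mono measurable_snd.comap_le
  rw [hcomp, ← MeasurableSpace.comap_comp, hφ]

/-- **Conditional expectations given (hitting time, stopped path) are martingale left limits read at
the stopped path.** For every real `ξ`, for `μ`-a.e. path `ω` with `ω 0 ∉ F`:
`μ[ξ | σ(τ_F, ω^{τ_F})] ω = lim_{q ↑ τ_F ω, q ∈ ℚ} μ[ξ | 𝔽 q] (ω^{τ_F})` — theorem (P)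
(`ae_tendsto_condExp_preHitting`) plus adaptedness of the rational martingale: `μ[ξ | 𝔽 q]` is a
function of the path stopped at `q` (`StronglyMeasurable.factorsThrough`), and `(ω^{τ_F})^q = ω^q`
for `q ≤ τ_F ω` (`comp_stop_of_le`). The right-hand side is an `F`-independent functional of the
pair. [folklore] -/
theorem condExp_comap_hitPair_ae_eq_limUnder
    (𝔽 : Filtration ℝ (inferInstance : MeasurableSpace C(unitInterval, ℂ)))
    (h𝔽 : ∀ t : ℝ,
      𝔽 t = MeasurableSpace.comap (fun ω : C(unitInterval, ℂ) => stp[t, ω]) inferInstance)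
    (μ : Measure C(unitInterval, ℂ)) [IsFiniteMeasure μ] {F : Set ℂ} (hF : IsClosed F)
    (ξ : C(unitInterval, ℂ) → ℝ) (h0 : ∀ᵐ ω ∂μ, ω 0 ∉ F) :
    μ[ξ|MeasurableSpace.comap (fun ω : C(unitInterval, ℂ) => (hit[F, ω], stp[hit[F, ω], ω]))
        inferInstance] =ᵐ[μ]
      fun ω => limUnder (comap (fun q : ℚ => (q : ℝ)) (𝓝[<] hit[F, ω]))
        (fun q : ℚ => μ[ξ|𝔽 (q : ℝ)] (stp[hit[F, ω], ω])) := by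
  rw [comap_hitPair_eq hF]
  -- adaptedness: `μ[ξ | 𝔽 q]` is a function of the path stopped at `q`
  have hfac : ∀ q : ℚ,
      (μ[ξ|𝔽 (q : ℝ)]).FactorsThrough fun ω : C(unitInterval, ℂ) => stp[(q : ℝ), ω] :=
    fun q => ((stronglyMeasurable_condExp (m := 𝔽 (q : ℝ)) (μ := μ) (f := ξ)).mono
      (h𝔽 (q : ℝ)).le).factorsThrough
  filter_upwards [ae_tendsto_condExp_preHitting 𝔽 h𝔽 μ hF ξ, h0] with ω hω h0ω
  haveI := neBot_comap_ratCast_nhdsLT hit[F, ω]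
  -- strictly before `τ_F ω` the martingale does not distinguish `ω` from its stopped version
  have hev : ∀ᶠ q : ℚ in comap (fun q : ℚ => (q : ℝ)) (𝓝[<] hit[F, ω]), (q : ℝ) < hit[F, ω] :=
    (eventually_mem_nhdsWithin : ∀ᶠ x in 𝓝[<] hit[F, ω], x ∈ Iio hit[F, ω]).comap
      fun q : ℚ => (q : ℝ)
  have hEq : (fun q : ℚ => μ[ξ|𝔽 (q : ℝ)] ω) =ᶠ[comap (fun q : ℚ => (q : ℝ)) (𝓝[<] hit[F, ω])]
      fun q : ℚ => μ[ξ|𝔽 (q : ℝ)] (stp[hit[F, ω], ω]) := by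
    filter_upwards [hev] with q hq
    exact hfac q (comp_stop_of_le (Set.monotone_projIcc zero_le_one hq.le) ω).symm
  exact ((hω h0ω).congr' hEq).limUnder_eq.symm

/-- **One kernel for all hitting times (soft-Markov brick E1).** For a finite measure on path space
whose paths start a.e. at `a`, there is ONE map `K : ℝ × C([0,1], ℂ) → Measure C([0,1], ℂ)` — built
from the martingale left limits of the indicators of a countable generating π-system, via the kernel
assembly `exists_forall_condDistrib_apply_ae_eq` — such that for EVERY closed `F ∌ a` the regular
conditional distribution of the path given `X_F = (τ_F, ω^{τ_F})` is `K ∘ X_F` almost surely.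
[folklore] -/
theorem exists_pathKernel
    (𝔽 : Filtration ℝ (inferInstance : MeasurableSpace C(unitInterval, ℂ)))
    (h𝔽 : ∀ t : ℝ,
      𝔽 t = MeasurableSpace.comap (fun ω : C(unitInterval, ℂ) => stp[t, ω]) inferInstance)
    (μ : Measure C(unitInterval, ℂ)) [IsFiniteMeasure μ] {a : ℂ} (ha : ∀ᵐ ω ∂μ, ω 0 = a) :
    ∃ K : ℝ × C(unitInterval, ℂ) → Measure C(unitInterval, ℂ), ∀ F : Set ℂ, IsClosed F → a ∉ F →
      ∀ᵐ ω ∂μ, condDistrib id (fun ω : C(unitInterval, ℂ) => (hit[F, ω], stp[hit[F, ω], ω])) μ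
        (hit[F, ω], stp[hit[F, ω], ω]) = K (hit[F, ω], stp[hit[F, ω], ω]) := by
  -- (1) a countable generating π-system of Borel sets of paths
  obtain ⟨A, hA, hpi, hgen⟩ := exists_seq_isPiSystem_generateFrom C(unitInterval, ℂ)
  -- (2) the kernel: martingale left limits of the indicators, read at the stopped path
  obtain ⟨K, hK⟩ := exists_forall_condDistrib_apply_ae_eq μ hA hpi hgen
    fun (k : ℕ) (p : ℝ × C(unitInterval, ℂ)) => limUnder (comap (fun q : ℚ => (q : ℝ)) (𝓝[<] p.1))
      (fun q : ℚ => μ[(A k).indicator (fun _ => (1 : ℝ))|𝔽 (q : ℝ)] p.2)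
  refine ⟨K, fun F hF haF => ?_⟩
  -- (3) for a closed `F ∌ a`, `Z k ∘ X_F` are versions of the conditional probabilities of the `A k`
  have h0 : ∀ᵐ ω ∂μ, ω 0 ∉ F := ha.mono fun ω hω => by rw [hω]; exact haF
  have hX : Measurable fun ω : C(unitInterval, ℂ) => (hit[F, ω], stp[hit[F, ω], ω]) :=
    (Curve.measurable_hitParam_mk hF).prodMk (measurable_stop_random (Curve.measurable_hitParam_mk hF))
  exact hK (fun ω : C(unitInterval, ℂ) => (hit[F, ω], stp[hit[F, ω], ω])) hX
    fun k => condExp_comap_hitPair_ae_eq_limUnder 𝔽 h𝔽 μ hF _ h0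

end PathSpace

/-! ### Registered sub-goal of crux stmt-CriticalPhenomena-1370 (line `registered`, stub `stub_markovOfLimit`) -/

section Registered

/-- **Registered sub-goal `stub_pathKernel`** (crux stmt-CriticalPhenomena-1370, soft-Markov line,
brick E1): `exists_pathKernel` with all binders explicit and notation-free — on the path space with its
canonical filtration, for every finite measure with a.e. starting point `a` there is one map
`K : ℝ × C([0,1], ℂ) → Measure C([0,1], ℂ)` which, for every closed `F ∌ a`, is a.s. the regular
conditional distribution of the path given (hitting time of `F`, path stopped there). [folklore] -/
theorem stub_pathKernel :
    ∀ [MeasurableSpace C(unitInterval, ℂ)] [BorelSpace C(unitInterval, ℂ)] (𝔽 : MeasureTheory.Filtration ℝ (inferInstance : MeasurableSpace C(unitInterval, ℂ))), (∀ t : ℝ, 𝔽 t = MeasurableSpace.comap (fun ω : C(unitInterval, ℂ) => ((ω).comp (ContinuousMap.id unitInterval ⊓ ContinuousMap.const unitInterval (Set.projIcc (0:ℝ) 1 zero_le_one (t))))) inferInstance) → ∀ (μ : MeasureTheory.Measure C(unitInterval, ℂ)) [MeasureTheory.IsFiniteMeasure μ] (a : ℂ), Filter.Eventually (fun ω : C(unitInterval,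 ℂ) => ω 0 = a) (MeasureTheory.ae μ) → ∃ K : ℝ × C(unitInterval, ℂ) → MeasureTheory.Measure C(unitInterval, ℂ), ∀ F : Set ℂ, IsClosed F → a ∉ F → Filter.Eventually (fun ω : C(unitInterval, ℂ) => (ProbabilityTheory.condDistrib id (fun ω : C(unitInterval, ℂ) => (((Literature.Probability.RandomPlanarGeometry.Curve.mk (ω)).hitParam F), ((ω).comp (ContinuousMap.id unitInterval ⊓ ContinuousMap.const unitInterval (Set.projIcc (0:ℝ) 1 zero_le_one (((Literature.Probability.RandomPlanarGeometry.Curve.mk (ω)).hitParam F))))))) μ) (((Literature.Probability.RandomPlanarGeometry.Curve.mk (ω)).hitParam F), ((ω).comp (ContinuousMap.id unitInterval ⊓ ContinuousMap.const unitInterval (Set.projIcc (0:ℝ) 1 zero_le_one (((Literature.Probability.RandomPlanarGeometry.Curve.mk (ω)).hitParam F)))))) = K (((Literature.Probability.RandomPlanarGeometry.Curve.mk (ω)).hitParam F), ((ω).comp (ContinuousMap.id unitInterval ⊓ ContinuousMap.const unitInterval (Set.projIcc (0:ℝ) 1 zero_le_one (((Literature.Probability.RandomPlanarGeometry.Curve.mk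 (ω)).hitParam F))))))) (MeasureTheory.ae μ) :=
  fun 𝔽 h𝔽 μ _ _ ha => exists_pathKernel 𝔽 h𝔽 μ ha

end Registered

end Summit.CriticalPhenomena.SAWScalingLimit.Theorems.AxiomsOfLimitMarkov

end
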